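import Mathlib.Analysis.SpecialFunctions.Exp
import Mathlib.Analysis.SpecialFunctions.Pow.Real
import Mathlib.Analysis.SpecialFunctions.Sqrt
import Mathlib.Algebra.Order.Field.GeomSum
import Mathlib.Algebra.BigOperators.Ring.Finset
import HarnessLib

/-!
# An elementary bound on partitions into distinct parts: `P_D(A) ≤ e^{3√A}`

Topic `Literature/Combinatorics/Enumerative`. Hardy–Ramanujan (1917) proved
`log P_D(A) ∼ π√(A/3)` for the number `P_D(A)` of partitions of `A` into distinct parts
(Madras–Slade, *The Self-Avoiding Walk* (1993), Theorem 3.1.4; Duminil-Copin–Kozma–Yadin 2014,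
Theorem 4). The unfolding arguments for self-avoiding walks (Hammersley–Welsh 1962,
Madras–Slade Proposition 3.1.5: `h_N ≤ P_D(N) b_N`; Duminil-Copin–Kozma–Yadin 2014, proof of
Lemma 5, Step 1) only use that such counts are `e^{O(√A)}`. This file PROVES the elementary
explicit bound, in the form those arguments consume:

* `card_finsetsOfSumLE_le_exp` — **the number of finite sets of positive integers with sum at
  most `n` is at most `e^{3√n}`** (a strictly monotone sequence of positive widths with total
  `≤ n` is such a set);
* `card_distinctPartitions_le_exp` — hence `P_D(A) ≤ e^{3√A}` for the sets with sum exactly `A`.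

Proof (the generating-function bound): for `0 ≤ x < 1`,
`Σ_{S ⊆ {1,…,n}} x^{ΣS} = ∏_{k=1}^{n} (1 + x^k) ≤ exp(Σ_{k=1}^{n} x^k) ≤ exp(x/(1-x))`
(`sum_pow_sum_eq_prod`, `prod_one_add_pow_le_exp`); each set with `ΣS ≤ n` contributes at least
`xⁿ`, and `x = e^{-1/√n}` gives `x⁻ⁿ = e^{√n}`, `x/(1-x) ≤ 2√n`.

Mathlib anchors: `Finset.prod_one_add`, `Finset.prod_pow_eq_pow_sum`, `Real.add_one_le_exp`,
`Real.exp_sum`, `geom_sum_Ico_le_of_lt_one`. Mathlib has `Nat.Partition.distincts` (Euler's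
partition theorem) but no growth bound for it.
-/

noncomputable section

open Finset Real
open scoped BigOperators

namespace Literature.Combinatorics.Enumerative

/-- The finite sets of positive integers with sum at most `n` (necessarily subsets of
`{1,…,n}`). [folklore] -/
def finsetsOfSumLE (n : ℕ) : Finset (Finset ℕ) :=
  (Icc 1 n).powerset.filter fun S => S.sum id ≤ n

/-- Membership in `finsetsOfSumLE`: a set of positive integers with sum `≤ n`. [folklore] -/
theorem mem_finsetsOfSumLE {n : ℕ} {S : Finset ℕ} :
    S ∈ finsetsOfSumLE n ↔ (∀ s ∈ S, 1 ≤ s) ∧ S.sum id ≤ n := by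
  rw [finsetsOfSumLE, mem_filter, mem_powerset]
  constructor
  · rintro ⟨hsub, hsum⟩
    exact ⟨fun s hs => (mem_Icc.1 (hsub hs)).1, hsum⟩
  · rintro ⟨hpos, hsum⟩
    refine ⟨fun s hs => mem_Icc.2 ⟨hpos s hs, ?_⟩, hsum⟩
    exact (Finset.single_le_sum (f := id) (fun _ _ => Nat.zero_le _) hs).trans hsum

/-- The partitions of `A` into distinct parts, as finite sets of positive integers with sum `A`
(`P_D(A)` is their number). [folklore] -/
def distinctPartitions (A : ℕ) : Finset (Finset ℕ) :=
  (Icc 1 A).powerset.filter fun S => S.sum id = A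

/-- Membership in `distinctPartitions`. [folklore] -/
theorem mem_distinctPartitions {A : ℕ} {S : Finset ℕ} :
    S ∈ distinctPartitions A ↔ (∀ s ∈ S, 1 ≤ s) ∧ S.sum id = A := by
  rw [distinctPartitions, mem_filter, mem_powerset]
  constructor
  · rintro ⟨hsub, hsum⟩
    exact ⟨fun s hs => (mem_Icc.1 (hsub hs)).1, hsum⟩
  · rintro ⟨hpos, hsum⟩
    refine ⟨fun s hs => mem_Icc.2 ⟨hpos s hs, ?_⟩, hsum⟩
    exact (Finset.single_le_sum (f := id) (fun _ _ => Nat.zero_le _) hs).trans hsum.le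

/-- Partitions into distinct parts are sets with sum at most `A`. [folklore] -/
theorem distinctPartitions_subset (A : ℕ) : distinctPartitions A ⊆ finsetsOfSumLE A := fun S hS => by
  rw [mem_distinctPartitions] at hS
  exact mem_finsetsOfSumLE.2 ⟨hS.1, hS.2.le⟩

/-- The generating function of the subsets of `{1,…,n}` by their sum is `∏ₖ (1 + xᵏ)`.
[folklore] -/
theorem sum_pow_sum_eq_prod (x : ℝ) (n : ℕ) :
    ∑ S ∈ (Icc 1 n).powerset, x ^ S.sum id = ∏ k ∈ Icc 1 n, (1 + x ^ k) := by
  rw [Finset.prod_one_add]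
  refine Finset.sum_congr rfl fun S _ => ?_
  rw [Finset.prod_pow_eq_pow_sum]
  rfl

/-- `∏_{k=1}^{n} (1 + xᵏ) ≤ exp(x/(1-x))` for `0 ≤ x < 1`. [folklore] -/
theorem prod_one_add_pow_le_exp {x : ℝ} (hx0 : 0 ≤ x) (hx1 : x < 1) (n : ℕ) :
    ∏ k ∈ Icc 1 n, (1 + x ^ k) ≤ Real.exp (x / (1 - x)) := by
  calc ∏ k ∈ Icc 1 n, (1 + x ^ k) ≤ ∏ k ∈ Icc 1 n, Real.exp (x ^ k) :=
        Finset.prod_le_prod (fun k _ => by positivity) fun k _ => by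
          linarith [Real.add_one_le_exp (x ^ k)]
    _ = Real.exp (∑ k ∈ Icc 1 n, x ^ k) := (Real.exp_sum _ _).symm
    _ ≤ Real.exp (x / (1 - x)) := by
        rw [Real.exp_le_exp]
        have h : ∑ k ∈ Ico 1 (n + 1), x ^ k ≤ x ^ 1 / (1 - x) := geom_sum_Ico_le_of_lt_one hx0 hx1
        rw [pow_one, Finset.Ico_add_one_right_eq_Icc] at h
        exact h

/-- **The number of finite sets of positive integers with sum at most `n` is at most
`e^{3√n}`.** [folklore] -/
theorem card_finsetsOfSumLE_le_exp (n : ℕ) :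
    ((finsetsOfSumLE n).card : ℝ) ≤ Real.exp (3 * Real.sqrt n) := by
  rcases Nat.eq_zero_or_pos n with rfl | hn
  · -- only the empty set
    have : finsetsOfSumLE 0 = {∅} := by
      ext S
      simp only [finsetsOfSumLE, mem_filter, mem_powerset, Finset.mem_singleton]
      constructor
      · rintro ⟨h, -⟩
        exact Finset.subset_empty.1 (by simpa using h)
      · rintro rfl; simp
    rw [this]
    simp
  -- `x = e^{-1/√n}`
  set t : ℝ := 1 / Real.sqrt n with ht
  set x : ℝ := Real.exp (-t) with hx
  have hn' : (0 : ℝ) < n := by exact_mod_cast hn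
  have hsq : 0 < Real.sqrt n := Real.sqrt_pos.2 hn'
  have ht0 : 0 < t := by rw [ht]; positivity
  have ht1 : t ≤ 1 := by
    rw [ht, div_le_one hsq, Real.le_sqrt (by norm_num) hn'.le]
    exact_mod_cast hn
  have hx0 : 0 < x := Real.exp_pos _
  have hx1 : x < 1 := Real.exp_lt_one_iff.mpr (by linarith)
  -- `1 - x ≥ t/2`, so `x/(1-x) ≤ 2/t = 2√n`
  have h1x : t / 2 ≤ 1 - x := by
    -- `e^{-t} ≤ 1/(1+t) ≤ 1 - t/2` on `[0,1]`
    have h1 : x * (1 + t) ≤ 1 := by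
      have := Real.add_one_le_exp t
      rw [hx, Real.exp_neg]
      rw [inv_mul_le_iff₀ (Real.exp_pos t)]
      linarith
    nlinarith
  have hfrac : x / (1 - x) ≤ 2 * Real.sqrt n := by
    rw [div_le_iff₀ (by linarith)]
    have : 2 * Real.sqrt n * (t / 2) = 1 := by
      rw [ht]; field_simp
    nlinarith [hx1]
  -- each set with sum `≤ n` contributes at least `xⁿ` to the generating function
  have hlow : ((finsetsOfSumLE n).card : ℝ) * x ^ n ≤ ∑ S ∈ (Icc 1 n).powerset, x ^ S.sum id := by
    calc ((finsetsOfSumLE n).card : ℝ) * x ^ n = ∑ S ∈ finsetsOfSumLE n, x ^ n := by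
          rw [Finset.sum_const, nsmul_eq_mul]
      _ ≤ ∑ S ∈ finsetsOfSumLE n, x ^ S.sum id :=
          Finset.sum_le_sum fun S hS =>
            pow_le_pow_of_le_one hx0.le hx1.le (mem_finsetsOfSumLE.1 hS).2
      _ ≤ ∑ S ∈ (Icc 1 n).powerset, x ^ S.sum id :=
          Finset.sum_le_sum_of_subset_of_nonneg (Finset.filter_subset _ _)
            fun _ _ _ => pow_nonneg hx0.le _
  -- `xⁿ = e^{-√n}`
  have hxn : x ^ n = Real.exp (-Real.sqrt n) := by
    rw [hx, ← Real.exp_nat_mul, ht]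
    congr 1
    rw [mul_neg, mul_one_div, Real.div_sqrt]
  have hgen : ∑ S ∈ (Icc 1 n).powerset, x ^ S.sum id ≤ Real.exp (2 * Real.sqrt n) := by
    rw [sum_pow_sum_eq_prod]
    exact (prod_one_add_pow_le_exp hx0.le hx1 n).trans (Real.exp_le_exp.2 hfrac)
  have hxn0 : 0 < x ^ n := pow_pos hx0 n
  calc ((finsetsOfSumLE n).card : ℝ) = ((finsetsOfSumLE n).card : ℝ) * x ^ n / x ^ n := by
        field_simp
    _ ≤ Real.exp (2 * Real.sqrt n) / x ^ n := div_le_div_of_nonneg_right (hlow.trans hgen) hxn0.le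
    _ = Real.exp (3 * Real.sqrt n) := by
        rw [hxn, ← Real.exp_sub]; ring_nf

/-- **`P_D(A) ≤ e^{3√A}`**: an explicit elementary form of the Hardy–Ramanujan growth
`log P_D(A) ∼ π√(A/3)` sufficient for the unfolding arguments. [folklore] -/
theorem card_distinctPartitions_le_exp (A : ℕ) :
    ((distinctPartitions A).card : ℝ) ≤ Real.exp (3 * Real.sqrt A) :=
  le_trans (by exact_mod_cast Finset.card_le_card (distinctPartitions_subset A))
    (card_finsetsOfSumLE_le_exp A)

/-- Pairs of sets of positive integers with total sum at most `n` (the pairs of width sequences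
of a two-sided unfolding) number at most `e^{6√n}`. [folklore] -/
theorem card_pairs_finsetsOfSumLE_le_exp (n : ℕ) :
    (((finsetsOfSumLE n ×ˢ finsetsOfSumLE n).filter
        fun p => p.1.sum id + p.2.sum id ≤ n).card : ℝ) ≤ Real.exp (6 * Real.sqrt n) := by
  have h := card_finsetsOfSumLE_le_exp n
  have h0 : (0 : ℝ) ≤ (finsetsOfSumLE n).card := Nat.cast_nonneg _
  calc (((finsetsOfSumLE n ×ˢ finsetsOfSumLE n).filter
          fun p => p.1.sum id + p.2.sum id ≤ n).card : ℝ)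
      ≤ ((finsetsOfSumLE n ×ˢ finsetsOfSumLE n).card : ℝ) := by
        exact_mod_cast Finset.card_filter_le _ _
    _ = ((finsetsOfSumLE n).card : ℝ) ^ 2 := by rw [Finset.card_product]; push_cast; ring
    _ ≤ Real.exp (3 * Real.sqrt n) ^ 2 := pow_le_pow_left₀ h0 h 2
    _ = Real.exp (6 * Real.sqrt n) := by rw [← Real.exp_nat_mul]; ring_nf

end Literature.Combinatorics.Enumerative
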